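import Mathlib

/-!
# THEOREM PROD ((CS) composition), Lemma A: the independent generators (p5, gen 16)

mine-3's product theorem for (CS) (`proofs/MINE3-PRODUCT.md` §1) rests on LEMMA A: for
`aᵢ, bᵢ ∈ [0, 1]` with `aᵢ + bᵢ ≥ 1` (the independent generators `e(aᵢ, bᵢ)` of the family `E1`),
with `U = 1 − Π (1 − aᵢ)`, `V = 1 − Π (1 − bᵢ)`, `𝒜 = Π (1 + aᵢ²) − 1`, `ℬ = Π (1 + bᵢ²) − 1`:
`U·V ≤ √(𝒜ℬ)`, here in the squared form `(U·V)² ≤ 𝒜·ℬ`.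

* `sum_z_mul` — the four expansions `Σ_W z_W c_{Wᶜ} = Π (zᵢ + cᵢ)` (`Finset.prod_add`),
  `zᵢ = aᵢ + bᵢ − 1`;
* `complement_identity` — the COMPLEMENT BOUND as an exact identity: with `xᵢ = 1 − aᵢ`,
  `yᵢ = 1 − bᵢ`,
  `Π (aᵢ + bᵢ) − Π aᵢ − Π bᵢ + Π aᵢ · Π bᵢ − U·V = Σ_{W ≠ ∅} z_W (1 − x_{Wᶜ}) (1 − y_{Wᶜ})`;
* `uv_le_matching` — hence `U·V ≤ Σ_{S ≠ ∅} p_S q_{σ(S)}` for the complement matching `σ` on the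
  nonempty subsets (`σ(S) = Sᶜ` for `∅ ≠ S ≠ s`, `σ(s) = s`; `p_S = Π_S aᵢ`, `q_T = Π_T bᵢ`);
* `sum_sq_eq` — `Σ_{S ≠ ∅} p_S² = Π (1 + aᵢ²) − 1`;
* **`lemmaA`** — `(U·V)² ≤ 𝒜·ℬ`: Cauchy–Schwarz along the involution `σ`
  (`Finset.sum_mul_sq_le_sq_mul_sq`).
-/

namespace PercRepro

namespace ProdCS

open Finset

variable {ι : Type*} [DecidableEq ι]

/-! ### The complement matching -/

/-- The complement matching on the subsets of `s`: `Sᶜ = s \ S` for `S ≠ s`, and `s ↦ s`. -/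
def sigma (s : Finset ι) (S : Finset ι) : Finset ι := if S = s then s else s \ S

/-- The nonempty subsets of `s`. -/
def nonempties (s : Finset ι) : Finset (Finset ι) := s.powerset.erase ∅

/-- Membership in the nonempty subsets. -/
theorem mem_nonempties {s S : Finset ι} : S ∈ nonempties s ↔ S ≠ ∅ ∧ S ⊆ s := by
  simp [nonempties]

/-- `σ` maps the nonempty subsets of `s` to themselves. -/
theorem sigma_mem {s S : Finset ι} (h : S ∈ nonempties s) : sigma s S ∈ nonempties s := by
  rw [mem_nonempties] at h ⊢
  unfold sigma
  split_ifs with hS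
  · exact ⟨hS ▸ h.1, subset_rfl⟩
  · refine ⟨fun h' => hS ?_, sdiff_subset⟩
    exact Finset.Subset.antisymm h.2 (Finset.sdiff_eq_empty_iff_subset.mp h')

/-- `σ` is an involution on the nonempty subsets of `s`. -/
theorem sigma_sigma {s S : Finset ι} (h : S ∈ nonempties s) : sigma s (sigma s S) = S := by
  rw [mem_nonempties] at h
  unfold sigma
  by_cases hS : S = s
  · simp [hS]
  · have h' : s \ S ≠ s := by
      intro h'
      apply h.1
      exact Finset.eq_empty_of_forall_notMem fun x hx =>
        Finset.disjoint_left.mp (Finset.sdiff_eq_self_iff_disjoint.mp h') (h.2 hx) hx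
    rw [if_neg hS, if_neg h', Finset.sdiff_sdiff_eq_self h.2]

/-! ### The four expansions and the complement identity -/

/-- `Σ_W z_W · c_{s \ W} = Π (zᵢ + cᵢ)` over all subsets `W` of `s`. -/
theorem sum_z_mul (s : Finset ι) (z c : ι → ℝ) :
    ∑ W ∈ s.powerset, (∏ i ∈ W, z i) * ∏ i ∈ s \ W, c i = ∏ i ∈ s, (z i + c i) :=
  (Finset.prod_add z c s).symm

/-- **The complement identity**: with `zᵢ = aᵢ + bᵢ − 1`, `xᵢ = 1 − aᵢ`, `yᵢ = 1 − bᵢ`,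
`Σ_{W ⊆ s} z_W (1 − x_{Wᶜ})(1 − y_{Wᶜ}) = Π (aᵢ + bᵢ) − Π bᵢ − Π aᵢ + Π aᵢ · Π bᵢ`. -/
theorem complement_identity (s : Finset ι) (a b : ι → ℝ) :
    ∑ W ∈ s.powerset, (∏ i ∈ W, (a i + b i - 1)) *
        ((1 - ∏ i ∈ s \ W, (1 - a i)) * (1 - ∏ i ∈ s \ W, (1 - b i))) =
      ∏ i ∈ s, (a i + b i) - ∏ i ∈ s, b i - ∏ i ∈ s, a i + (∏ i ∈ s, a i) * ∏ i ∈ s, b i := by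
  have e1 := sum_z_mul s (fun i => a i + b i - 1) (fun _ => (1 : ℝ))
  have e2 := sum_z_mul s (fun i => a i + b i - 1) (fun i => 1 - a i)
  have e3 := sum_z_mul s (fun i => a i + b i - 1) (fun i => 1 - b i)
  have e4 := sum_z_mul s (fun i => a i + b i - 1) (fun i => (1 - a i) * (1 - b i))
  simp only [Finset.prod_const_one, mul_one] at e1
  have f1 : ∏ i ∈ s, (a i + b i - 1 + 1) = ∏ i ∈ s, (a i + b i) :=
    Finset.prod_congr rfl fun i _ => by ring
  have f2 : ∏ i ∈ s, (a i + b i - 1 + (1 - a i)) = ∏ i ∈ s, b i :=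
    Finset.prod_congr rfl fun i _ => by ring
  have f3 : ∏ i ∈ s, (a i + b i - 1 + (1 - b i)) = ∏ i ∈ s, a i :=
    Finset.prod_congr rfl fun i _ => by ring
  have f4 : ∏ i ∈ s, (a i + b i - 1 + (1 - a i) * (1 - b i)) = (∏ i ∈ s, a i) * ∏ i ∈ s, b i := by
    rw [← Finset.prod_mul_distrib]
    exact Finset.prod_congr rfl fun i _ => by ring
  rw [f1] at e1
  rw [f2] at e2
  rw [f3] at e3
  rw [f4] at e4
  rw [← e4, ← e3, ← e2, ← e1, ← Finset.sum_sub_distrib, ← Finset.sum_sub_distrib,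
    ← Finset.sum_add_distrib]
  refine Finset.sum_congr rfl fun W _ => ?_
  rw [Finset.prod_mul_distrib]
  ring

/-- The nonnegative summands of the complement identity. -/
theorem summand_nonneg {s : Finset ι} {a b : ι → ℝ} (ha : ∀ i ∈ s, 0 ≤ a i ∧ a i ≤ 1)
    (hb : ∀ i ∈ s, 0 ≤ b i ∧ b i ≤ 1) (hab : ∀ i ∈ s, 1 ≤ a i + b i) {W : Finset ι}
    (hW : W ⊆ s) :
    0 ≤ (∏ i ∈ W, (a i + b i - 1)) *
      ((1 - ∏ i ∈ s \ W, (1 - a i)) * (1 - ∏ i ∈ s \ W, (1 - b i))) := by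
  refine mul_nonneg (Finset.prod_nonneg fun i hi => by linarith [hab i (hW hi)])
    (mul_nonneg (sub_nonneg.2 (Finset.prod_le_one (fun i hi => ?_) fun i hi => ?_))
      (sub_nonneg.2 (Finset.prod_le_one (fun i hi => ?_) fun i hi => ?_)))
  · linarith [(ha i (Finset.mem_sdiff.mp hi).1).2]
  · linarith [(ha i (Finset.mem_sdiff.mp hi).1).1]
  · linarith [(hb i (Finset.mem_sdiff.mp hi).1).2]
  · linarith [(hb i (Finset.mem_sdiff.mp hi).1).1]

/-- **The complement bound**: `U·V ≤ Π (aᵢ + bᵢ) − Π aᵢ − Π bᵢ + Π aᵢ · Π bᵢ`. -/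
theorem uv_le (s : Finset ι) {a b : ι → ℝ} (ha : ∀ i ∈ s, 0 ≤ a i ∧ a i ≤ 1)
    (hb : ∀ i ∈ s, 0 ≤ b i ∧ b i ≤ 1) (hab : ∀ i ∈ s, 1 ≤ a i + b i) :
    (1 - ∏ i ∈ s, (1 - a i)) * (1 - ∏ i ∈ s, (1 - b i)) ≤
      ∏ i ∈ s, (a i + b i) - ∏ i ∈ s, b i - ∏ i ∈ s, a i + (∏ i ∈ s, a i) * ∏ i ∈ s, b i := by
  rw [← complement_identity, ← Finset.add_sum_erase _ _ (Finset.empty_mem_powerset s)]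
  simp only [Finset.prod_empty, one_mul, Finset.sdiff_empty]
  refine le_add_of_nonneg_right (Finset.sum_nonneg fun W hW => ?_)
  exact summand_nonneg ha hb hab (Finset.mem_powerset.mp (Finset.mem_of_mem_erase hW))

/-! ### The matching sum and the squares -/

/-- The matching sum `Σ_{S ≠ ∅} p_S q_{σ(S)}` equals the complement bound. -/
theorem matching_sum_eq (s : Finset ι) (a b : ι → ℝ) :
    ∑ S ∈ nonempties s, (∏ i ∈ S, a i) * ∏ i ∈ sigma s S, b i =
      ∏ i ∈ s, (a i + b i) - ∏ i ∈ s, b i - ∏ i ∈ s, a i + (∏ i ∈ s, a i) * ∏ i ∈ s, b i := by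
  rcases eq_or_ne s ∅ with rfl | hs
  · simp [nonempties]
  have hs' : s ∈ nonempties s := mem_nonempties.mpr ⟨hs, subset_rfl⟩
  have hempty : ∅ ∈ s.powerset := Finset.empty_mem_powerset s
  have hs'' : s ∈ s.powerset.erase ∅ := hs'
  have hrest : ∑ S ∈ (nonempties s).erase s, (∏ i ∈ S, a i) * ∏ i ∈ sigma s S, b i =
      ∑ S ∈ (s.powerset.erase ∅).erase s, (∏ i ∈ S, a i) * ∏ i ∈ s \ S, b i := by
    refine Finset.sum_congr rfl fun S hS => ?_
    have hSs : S ≠ s := Finset.ne_of_mem_erase hS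
    simp [sigma, hSs]
  have hself : sigma s s = s := if_pos rfl
  -- split off `S = s` from the matching sum, `S = ∅` and `S = s` from the full expansion
  rw [← Finset.add_sum_erase _ _ hs', Finset.prod_add a b s, ← Finset.add_sum_erase _ _ hempty,
    ← Finset.add_sum_erase _ _ hs'', hrest, hself]
  simp only [Finset.prod_empty, one_mul, Finset.sdiff_empty, Finset.sdiff_self, mul_one]
  ring

/-- `Σ_{S ≠ ∅} p_S² = Π (1 + aᵢ²) − 1`. -/
theorem sum_sq_eq (s : Finset ι) (a : ι → ℝ) :
    ∑ S ∈ nonempties s, (∏ i ∈ S, a i) ^ 2 = ∏ i ∈ s, (1 + a i ^ 2) - 1 := by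
  have h := Finset.prod_add (fun i => a i ^ 2) (fun _ => (1 : ℝ)) s
  simp only [Finset.prod_const_one, mul_one, Finset.prod_pow] at h
  have h' : ∏ i ∈ s, (1 + a i ^ 2) = ∏ i ∈ s, (a i ^ 2 + 1) :=
    Finset.prod_congr rfl fun i _ => by ring
  rw [h', h, ← Finset.add_sum_erase _ _ (Finset.empty_mem_powerset s)]
  simp only [Finset.prod_empty, one_pow, nonempties]
  ring

/-- Reindexing along the involution `σ`: `Σ_{S ≠ ∅} q_{σ(S)}² = Σ_{S ≠ ∅} q_S²`. -/
theorem sum_sigma_sq (s : Finset ι) (b : ι → ℝ) :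
    ∑ S ∈ nonempties s, (∏ i ∈ sigma s S, b i) ^ 2 = ∑ S ∈ nonempties s, (∏ i ∈ S, b i) ^ 2 :=
  Finset.sum_nbij' (sigma s) (sigma s) (fun _ hS => sigma_mem hS) (fun _ hS => sigma_mem hS)
    (fun _ hS => sigma_sigma hS) (fun _ hS => sigma_sigma hS) (fun _ _ => rfl)

omit [DecidableEq ι] in
/-- `0 ≤ U·V`. -/
theorem uv_nonneg (s : Finset ι) {a b : ι → ℝ} (ha : ∀ i ∈ s, 0 ≤ a i ∧ a i ≤ 1)
    (hb : ∀ i ∈ s, 0 ≤ b i ∧ b i ≤ 1) :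
    0 ≤ (1 - ∏ i ∈ s, (1 - a i)) * (1 - ∏ i ∈ s, (1 - b i)) := by
  refine mul_nonneg (sub_nonneg.2 (Finset.prod_le_one (fun i hi => ?_) fun i hi => ?_))
    (sub_nonneg.2 (Finset.prod_le_one (fun i hi => ?_) fun i hi => ?_))
  · linarith [(ha i hi).2]
  · linarith [(ha i hi).1]
  · linarith [(hb i hi).2]
  · linarith [(hb i hi).1]

/-- **LEMMA A** (mine-3, `MINE3-PRODUCT.md` §1): for `aᵢ, bᵢ ∈ [0, 1]` with `aᵢ + bᵢ ≥ 1`,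
`(U·V)² ≤ 𝒜·ℬ` with `U = 1 − Π (1 − aᵢ)`, `V = 1 − Π (1 − bᵢ)`, `𝒜 = Π (1 + aᵢ²) − 1`,
`ℬ = Π (1 + bᵢ²) − 1` — the (CS) inequality `N ≤ √(𝒜ℬ)` for a product of independent generators
`e(aᵢ, bᵢ)` of `E1` (where `N = U·V`). Proof: the complement bound `U·V ≤ Σ_{S ≠ ∅} p_S q_{σ(S)}`
and Cauchy–Schwarz along the involution `σ`. -/
theorem lemmaA (s : Finset ι) {a b : ι → ℝ} (ha : ∀ i ∈ s, 0 ≤ a i ∧ a i ≤ 1)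
    (hb : ∀ i ∈ s, 0 ≤ b i ∧ b i ≤ 1) (hab : ∀ i ∈ s, 1 ≤ a i + b i) :
    ((1 - ∏ i ∈ s, (1 - a i)) * (1 - ∏ i ∈ s, (1 - b i))) ^ 2 ≤
      (∏ i ∈ s, (1 + a i ^ 2) - 1) * (∏ i ∈ s, (1 + b i ^ 2) - 1) := by
  have h1 : (1 - ∏ i ∈ s, (1 - a i)) * (1 - ∏ i ∈ s, (1 - b i)) ≤
      ∑ S ∈ nonempties s, (∏ i ∈ S, a i) * ∏ i ∈ sigma s S, b i := by
    rw [matching_sum_eq]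
    exact uv_le s ha hb hab
  have h2 := Finset.sum_mul_sq_le_sq_mul_sq (nonempties s) (fun S => ∏ i ∈ S, a i)
    (fun S => ∏ i ∈ sigma s S, b i)
  rw [sum_sigma_sq, sum_sq_eq, sum_sq_eq] at h2
  calc ((1 - ∏ i ∈ s, (1 - a i)) * (1 - ∏ i ∈ s, (1 - b i))) ^ 2
      ≤ (∑ S ∈ nonempties s, (∏ i ∈ S, a i) * ∏ i ∈ sigma s S, b i) ^ 2 :=
        pow_le_pow_left₀ (uv_nonneg s ha hb) h1 2
    _ ≤ _ := h2

end ProdCS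

end PercRepro
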